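import Mathlib
import Literature.AlgebraicGeometry.Resolution.AugmentationIdeal

/-!
# R-T rung, `J₅`, `μ₂`-vertex: the twisted-root cover laws — augmentation `(s)` and the commuting deck involution

(crux stmt-ResolutionOfSingularities-15640 `WildQuotients.WildQuotientResolution`, line `Sketch`,
sector `|G| = p`; RUNG V5 of `L/w45c/CHAIN.md` v8.1, brick B7/`HP₂` step (α) of res-L1-w45c-plan-1's
RULING 2026-08-27T11:12Z («explicit twisted-root cover U₂ → W₂ with lifted σ_U, deck involution τ,
aug(σ_U) = (s) principal»); coordinates of res-type-036's PROPOSAL 2026-08-27T11:25:02Z, machine-checked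
kit j277185 (design source res-L1-w45c-idea-2 `RT-J5.md` §5: «σ moves Y₃ = x₃/s by s·(x₂/s²) =
s·unit, so aug(σ̃) = (s) is principal (K–L applies)»). [OURS · L1 W4.5c] — NOT a statement of any
manuscript; replaces the role of no printed item. Prover res-type-036. Def-free; the ring `U` and
the two endomorphisms are ABSTRACT, given by their laws on six named elements.)

The `μ₂`-vertex `x_c` of the `(4,3,2,1)`-weighted blow-up for `J₅` carries the `σ`-invariant twisted
radicand `R₂ = −j₃/i₂` (RT-J5 §5; existence: `TwistedRoot.exists_twistedRadicand`, p521988). On the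
twisted-root cover (`s² = R₂`) with coordinates `Y₀ = x_a/s⁴`, `Y₁ = x_b/s³`, `Y₂ = x_c/s²` (a unit
along the vertex curve), `Y₃ = x_d/s`, `Y₄ = x_e`, the lifted action is POLYNOMIAL and TRIANGULAR:
`σ̃ : s ↦ s, Y₀ ↦ Y₀, Y₁ ↦ Y₁ + sY₀, Y₂ ↦ Y₂ + sY₁, Y₃ ↦ Y₃ + sY₂, Y₄ ↦ Y₄ + sY₃`, and the deck
involution is `τ : s, Y₁, Y₃ ↦ −s, −Y₁, −Y₃`, `Y₀, Y₂, Y₄` fixed (= res-L1-w45c-idea-2 `W2-DESIGN.md` §6, same minute, same letters). This file records, for ANY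
commutative ring `U` with endomorphisms satisfying these laws:

* generic bookkeeping: `sub_mem_of_mem_adjoin` / `augIdeal_eq_span_image_of_adjoin_eq_top` — the
  augmentation ideal of an algebra endomorphism is generated by the augmentations of algebra
  generators (twisted Leibniz rule); `augIdeal_quotientMap` — augmentation ideals pass to quotients;
* `mu2Cover_sub_mem_span_s` — every generator's augmentation lies in `(s)`;
  `mu2Cover_s_mul_mem_augIdeal` — `s·(Y₀, Y₁, Y₂, Y₃) ⊆ I_σ̃`; `mu2Cover_s_mem_augIdeal(_of_isUnit)` —
  `s ∈ I_σ̃` as soon as `Y₂` (on the core) or any element of `(Y₀, Y₁, Y₂, Y₃)` (on `W₂`: `î = i₂/s⁴`)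
  is a unit; hence `mu2Cover_augIdeal_eq_span_s` — **`I_σ̃ = (s)`** when `U` is generated over a
  `σ̃`-fixed base by `s, Y₀, …, Y₄` and `σ̃`-fixed elements (K–L TERMINAL; the fixed divisor is
  `{s = 0}` = the exceptional divisor);
* `mu2Cover_comm` — `σ̃ ∘ τ = τ ∘ σ̃` on such `U`; `mu2Cover_tau_anti` bookkeeping of the three
  anti-invariant coordinates (`s, Y₁, Y₃`: transversal type `½(1,1,1)`).
No relation (`F = 2I + J` of the PROPOSAL) is used here: the laws alone give the augmentation.
-/

-- single-problem summit: the doubled namespace component `ResolutionOfSingularities` is forced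
set_option linter.dupNamespace false

noncomputable section

namespace Summit.ResolutionOfSingularities.ResolutionOfSingularities.Theorems.WildQuotientResolution.JordanFive

open Literature.AlgebraicGeometry.Resolution (augIdeal sub_mem_augIdeal)

section Generators

variable {R A : Type*} [CommSemiring R] [CommRing A] [Algebra R A]

/-- **Twisted Leibniz bookkeeping.** If the augmentations `σ g − g` of a set `G` of algebra
generators lie in an ideal `J`, then so does `σ b − b` for every `b ∈ R[G]`
(`σ (xy) − xy = (σ x − x)·σ y + x·(σ y − y)`; constants are fixed). [folklore;
cite: KiralyLutkebohmert2013, Remark 3 (i)] -/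
theorem sub_mem_of_mem_adjoin (σ : A →ₐ[R] A) (J : Ideal A) (G : Set A)
    (hG : ∀ g ∈ G, σ g - g ∈ J) {b : A} (hb : b ∈ Algebra.adjoin R G) : σ b - b ∈ J := by
  induction hb using Algebra.adjoin_induction with
  | mem g hg => exact hG g hg
  | algebraMap r =>
    rw [AlgHom.commutes, sub_self]
    exact zero_mem _
  | add x y _ _ hx hy =>
    rw [map_add, show σ x + σ y - (x + y) = (σ x - x) + (σ y - y) by ring]
    exact add_mem hx hy
  | mul x y _ _ hx hy =>
    rw [map_mul, show σ x * σ y - x * y = (σ x - x) * σ y + x * (σ y - y) by ring]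
    exact add_mem (Ideal.mul_mem_right _ _ hx) (Ideal.mul_mem_left _ _ hy)

/-- **The augmentation ideal is generated by the augmentations of algebra generators.**
[folklore] -/
theorem augIdeal_eq_span_image_of_adjoin_eq_top (σ : A →ₐ[R] A) (G : Set A)
    (hG : Algebra.adjoin R G = ⊤) :
    augIdeal σ = Ideal.span ((fun g => σ g - g) '' G) := by
  apply le_antisymm
  · refine Ideal.span_le.2 ?_
    rintro _ ⟨b, rfl⟩
    exact sub_mem_of_mem_adjoin σ _ G (fun g hg => Ideal.subset_span (Set.mem_image_of_mem _ hg))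
      (by rw [hG]; exact Algebra.mem_top)
  · refine Ideal.span_le.2 ?_
    rintro _ ⟨g, -, rfl⟩
    exact sub_mem_augIdeal σ g

/-- **Augmentation ideals pass to quotients**: if `σ` preserves the ideal `I`, the augmentation ideal
of the induced endomorphism of `A ⧸ I` is the image of the augmentation ideal of `σ`. [folklore] -/
theorem augIdeal_quotientMap {A : Type*} [CommRing A] (σ : A →+* A) (I : Ideal A)
    (hI : I ≤ I.comap σ) :
    augIdeal (Ideal.quotientMap I σ hI) = (augIdeal σ).map (Ideal.Quotient.mk I) := by
  apply le_antisymm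
  · refine Ideal.span_le.2 ?_
    rintro _ ⟨q, rfl⟩
    obtain ⟨b, rfl⟩ := Ideal.Quotient.mk_surjective q
    change Ideal.quotientMap I σ hI (Ideal.Quotient.mk I b) - Ideal.Quotient.mk I b ∈
      (augIdeal σ).map (Ideal.Quotient.mk I)
    rw [Ideal.quotientMap_mk, ← map_sub]
    exact Ideal.mem_map_of_mem _ (sub_mem_augIdeal σ b)
  · rw [Literature.AlgebraicGeometry.Resolution.augIdeal_def σ, Ideal.map_span]
    refine Ideal.span_le.2 ?_
    rintro _ ⟨_, ⟨b, rfl⟩, rfl⟩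
    rw [map_sub, ← Ideal.quotientMap_mk (f := σ) (H := hI)]
    exact sub_mem_augIdeal _ _

end Generators

section Laws

variable {U : Type*} [CommRing U] (σ : U →+* U) (s Y₀ Y₁ Y₂ Y₃ Y₄ : U)
  (hs : σ s = s) (h0 : σ Y₀ = Y₀) (h1 : σ Y₁ = Y₁ + s * Y₀) (h2 : σ Y₂ = Y₂ + s * Y₁)
  (h3 : σ Y₃ = Y₃ + s * Y₂) (h4 : σ Y₄ = Y₄ + s * Y₃)

include hs h0 h1 h2 h3 h4 in
/-- **The six augmentations are multiples of `s`**: `σ̃ v − v = 0, 0, sY₀, sY₁, sY₂, sY₃` for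
`v = s, Y₀, Y₁, Y₂, Y₃, Y₄`. [OURS · L1 W4.5c; kit j277185] -/
theorem mu2Cover_sub_mem_span_s :
    ∀ v ∈ ({s, Y₀, Y₁, Y₂, Y₃, Y₄} : Set U), σ v - v ∈ Ideal.span {s} := by
  intro v hv
  simp only [Set.mem_insert_iff, Set.mem_singleton_iff] at hv
  rcases hv with rfl | rfl | rfl | rfl | rfl | rfl
  · rw [hs, sub_self]; exact zero_mem _
  · rw [h0, sub_self]; exact zero_mem _
  · rw [h1, add_sub_cancel_left]; exact Ideal.mul_mem_right _ _ (Ideal.mem_span_singleton_self s)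
  · rw [h2, add_sub_cancel_left]; exact Ideal.mul_mem_right _ _ (Ideal.mem_span_singleton_self s)
  · rw [h3, add_sub_cancel_left]; exact Ideal.mul_mem_right _ _ (Ideal.mem_span_singleton_self s)
  · rw [h4, add_sub_cancel_left]; exact Ideal.mul_mem_right _ _ (Ideal.mem_span_singleton_self s)

include h3 in
/-- **`s ∈ I_σ̃` when `Y₂` is a unit** (on the core `Y₂ = 1`): `σ̃ Y₃ − Y₃ = s·Y₂`. [OURS · L1 W4.5c] -/
theorem mu2Cover_s_mem_augIdeal (hunit : IsUnit Y₂) : s ∈ augIdeal σ := by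
  obtain ⟨v, hv⟩ := hunit
  have e : (σ Y₃ - Y₃) * ↑v⁻¹ = s := by
    rw [h3, add_sub_cancel_left, ← hv, mul_assoc, Units.mul_inv, mul_one]
  rw [← e]
  exact Ideal.mul_mem_right _ _ (sub_mem_augIdeal σ Y₃)

include h1 h2 h3 h4 in
/-- **`s · z ∈ I_σ̃` for every `z ∈ (Y₀, Y₁, Y₂, Y₃)`**: the four augmentations are `sY₀, sY₁, sY₂, sY₃`.
[OURS · L1 W4.5c] -/
theorem mu2Cover_s_mul_mem_augIdeal {z : U} (hz : z ∈ Ideal.span ({Y₀, Y₁, Y₂, Y₃} : Set U)) :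
    s * z ∈ augIdeal σ := by
  have hgen : ∀ w ∈ ({Y₀, Y₁, Y₂, Y₃} : Set U), s * w ∈ augIdeal σ := by
    intro w hw
    simp only [Set.mem_insert_iff, Set.mem_singleton_iff] at hw
    rcases hw with rfl | rfl | rfl | rfl
    · rw [show s * w = σ Y₁ - Y₁ by rw [h1]; ring]; exact sub_mem_augIdeal σ Y₁
    · rw [show s * w = σ Y₂ - Y₂ by rw [h2]; ring]; exact sub_mem_augIdeal σ Y₂
    · rw [show s * w = σ Y₃ - Y₃ by rw [h3]; ring]; exact sub_mem_augIdeal σ Y₃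
    · rw [show s * w = σ Y₄ - Y₄ by rw [h4]; ring]; exact sub_mem_augIdeal σ Y₄
  induction hz using Submodule.span_induction with
  | mem w hw => exact hgen w hw
  | zero => rw [mul_zero]; exact zero_mem _
  | add x y _ _ hx hy => rw [mul_add]; exact add_mem hx hy
  | smul r x _ hx =>
    rw [smul_eq_mul, mul_left_comm]
    exact Ideal.mul_mem_left _ _ hx

include h1 h2 h3 h4 in
/-- **`s ∈ I_σ̃` as soon as some element of `(Y₀, Y₁, Y₂, Y₃)` is a unit** — on `W₂ = D₊(i₂³t) ⊓ …`
take `î = i₂/s⁴ ∈ (Y₀, Y₁, Y₂, Y₃)` (W2-DESIGN §6). [OURS · L1 W4.5c] -/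
theorem mu2Cover_s_mem_augIdeal_of_isUnit {z : U} (hz : z ∈ Ideal.span ({Y₀, Y₁, Y₂, Y₃} : Set U))
    (hunit : IsUnit z) : s ∈ augIdeal σ := by
  obtain ⟨v, hv⟩ := hunit
  have h := mu2Cover_s_mul_mem_augIdeal σ s Y₀ Y₁ Y₂ Y₃ Y₄ h1 h2 h3 h4 hz
  rw [← hv] at h
  have e : s * ↑v * ↑v⁻¹ = s := by rw [mul_assoc, Units.mul_inv, mul_one]
  rw [← e]
  exact Ideal.mul_mem_right _ _ h

/-- **`I_σ̃ = (s)` (K–L terminal)** for an algebra endomorphism with the cover laws on a ring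
generated, over a base it fixes, by `s, Y₀, Y₁, Y₂, Y₃, Y₄` together with further FIXED elements
(inverted units, passengers), when some element of `(Y₀, Y₁, Y₂, Y₃)` is a unit — on `W₂` this is
`î = i₂/s⁴ = Y₂² − 2Y₁Y₃ + 2Y₀Y₄ + s(3Y₀Y₃ − Y₁Y₂) + s²Y₀Y₂` (res-L1-w45c-idea-2 W2-DESIGN §6), on the
core `Y₂` itself. [OURS · L1 W4.5c] -/
theorem mu2Cover_augIdeal_eq_span_s {R : Type*} [CommSemiring R] [Algebra R U] (σA : U →ₐ[R] U)
    (hs : σA s = s) (h0 : σA Y₀ = Y₀) (h1 : σA Y₁ = Y₁ + s * Y₀) (h2 : σA Y₂ = Y₂ + s * Y₁)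
    (h3 : σA Y₃ = Y₃ + s * Y₂) (h4 : σA Y₄ = Y₄ + s * Y₃)
    {z : U} (hz : z ∈ Ideal.span ({Y₀, Y₁, Y₂, Y₃} : Set U)) (hunit : IsUnit z)
    (G : Set U) (hGfix : ∀ g ∈ G, σA g = g)
    (hgen : Algebra.adjoin R (({s, Y₀, Y₁, Y₂, Y₃, Y₄} : Set U) ∪ G) = ⊤) :
    augIdeal σA = Ideal.span {s} := by
  apply le_antisymm
  · refine Ideal.span_le.2 ?_
    rintro _ ⟨b, rfl⟩
    refine sub_mem_of_mem_adjoin σA _ _ (fun g hg => ?_) (by rw [hgen]; exact Algebra.mem_top)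
    rcases hg with hg | hg
    · exact mu2Cover_sub_mem_span_s (σA : U →+* U) s Y₀ Y₁ Y₂ Y₃ Y₄ hs h0 h1 h2 h3 h4 g hg
    · rw [hGfix g hg, sub_self]; exact zero_mem _
  · rw [Ideal.span_singleton_le_iff_mem]
    exact mu2Cover_s_mem_augIdeal_of_isUnit (σA : U →+* U) s Y₀ Y₁ Y₂ Y₃ Y₄ h1 h2 h3 h4 hz hunit

variable (τ : U →+* U) (τs : τ s = -s) (τ0 : τ Y₀ = Y₀) (τ1 : τ Y₁ = -Y₁) (τ2 : τ Y₂ = Y₂)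
  (τ3 : τ Y₃ = -Y₃) (τ4 : τ Y₄ = Y₄)

include hs h0 h1 h2 h3 h4 τs τ0 τ1 τ2 τ3 τ4 in
/-- **`σ̃` and the deck involution commute on the six coordinates.** [OURS · L1 W4.5c; kit j277185] -/
theorem mu2Cover_comm_generators :
    ∀ v ∈ ({s, Y₀, Y₁, Y₂, Y₃, Y₄} : Set U), σ (τ v) = τ (σ v) := by
  intro v hv
  simp only [Set.mem_insert_iff, Set.mem_singleton_iff] at hv
  rcases hv with rfl | rfl | rfl | rfl | rfl | rfl
  · rw [τs, map_neg, hs, τs]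
  · rw [τ0, h0, τ0]
  · rw [τ1, map_neg, h1, map_add, map_mul, τ1, τs, τ0]; ring
  · rw [τ2, h2, map_add, map_mul, τ2, τs, τ1]; ring
  · rw [τ3, map_neg, h3, map_add, map_mul, τ3, τs, τ2]; ring
  · rw [τ4, h4, map_add, map_mul, τ4, τs, τ3]; ring

include hs h0 h1 h2 h3 h4 τs τ0 τ1 τ2 τ3 τ4 in
/-- **`σ̃ ∘ τ = τ ∘ σ̃`** on the subring generated by the six coordinates and any set of elements on
which both endomorphisms already commute (e.g. the base field and the passengers). [OURS · L1 W4.5c] -/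
theorem mu2Cover_comm (G : Set U) (hG : ∀ g ∈ G, σ (τ g) = τ (σ g)) {b : U}
    (hb : b ∈ Subring.closure (({s, Y₀, Y₁, Y₂, Y₃, Y₄} : Set U) ∪ G)) : σ (τ b) = τ (σ b) := by
  have key : Set.EqOn (σ.comp τ) (τ.comp σ)
      ↑(Subring.closure (({s, Y₀, Y₁, Y₂, Y₃, Y₄} : Set U) ∪ G)) := by
    refine RingHom.eqOn_set_closure ?_
    rintro g (hg | hg)
    · exact mu2Cover_comm_generators σ s Y₀ Y₁ Y₂ Y₃ Y₄ hs h0 h1 h2 h3 h4 τ τs τ0 τ1 τ2 τ3 τ4 g hg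
    · exact hG g hg
  exact key hb

include τs τ1 τ3 in
/-- The three ANTI-invariant coordinates `s, Y₁, Y₃` of the deck involution (transversal type
`½(1,1,1)` along the image of the `μ₂`-vertex curve; RT-J5 §5). [OURS · L1 W4.5c] -/
theorem mu2Cover_tau_anti : ∀ v ∈ ({s, Y₁, Y₃} : Set U), τ v = -v := by
  intro v hv
  simp only [Set.mem_insert_iff, Set.mem_singleton_iff] at hv
  rcases hv with rfl | rfl | rfl
  exacts [τs, τ1, τ3]

end Laws

end Summit.ResolutionOfSingularities.ResolutionOfSingularities.Theorems.WildQuotientResolution.JordanFive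

end
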